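import Summits.QuantumFields.YangMills.Theorems.BalabanUVNodesPortS1RecordDtReal

/-!
# Port S1, socket (o3)-V — ★★ DEF-1's (o3) FORMULA `recordDtJacOf` AT THE `recordDt` FAMILY IS NON-JUNK AND EXPLICIT:
# `fderiv ℝ recordDtCorrOf` = the real restriction of `h_ℂ ∘L DD̃(↑y)`, `det_ℝ(id − D corr) = det_ℂ(1 − h_ℂ∘DD̃(↑y))`, and
# `recordDtJacOf … Vk g x = −log ‖det(1 + h_ℂ ∘L DC̃_ℂ(↑Y_g(x)))‖` with `Y_g(x) = recordReparamOf … g x` ([I] (2.12) p.268 «Tr log(I − h(δ∕δB)D̃)(g_kCB)»)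

Cell `ym-nodeO-ideate`, porter seat PT-A-1 (gen 10); `--kind proof --supports stmt-QuantumFields-27930 --as helper`; count-neutral.  [I] = [Balaban1987RG1]; [15] = [Balaban1985Variational].
Director-ym R702-ym docket (1) (o3) «det∕Tr-log of `1 + h_ℂ∘DC̃_ℂ(B′)`»: this file closes the `det` half AT ★★ DEF-1's NAMES (✓`…K0RecordFormatNamesFluctInt` §24q `recordDtCorrOf`∕`recordReparamOf`∕`recordDtJacOf`,
`Dt := fun Vk => recordDt F k K Vk ρ` as in ✓`…FluctIntRec`'s `recordFluctData`), over ✓`…PortS1RecordDtHol` (p828685: `DD̃`, Jacobian identity, `det·det = 1`) and ✓`…PortS1RecordDtReal` (p828820: reality).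

WHAT IS PROVED (letters (o1-ε) at a quantified radius `ρ`; `R = 1∕(10⁸dL)`, `C₂ = 2∕R²`; `ι y := (j ↦ ↑(y j))`):
* §1 ★★ `hasFDerivAt_recordDtCorrOf_recordDt` — `y ↦ recordDtCorrOf … Vk y` is Fréchet-differentiable at every real `y` with `‖ι y‖ < ρ`, derivative = `Re ∘ (h_ℂ ∘L DD̃(ι y))|_ℝ ∘ ι` (chain rule);
  ★★ `im_hop_fderiv_recordDt_ofReal_eq_zero` — `h_ℂ(DD̃(ι y)(ι v))` IS REAL for real directions `v` (the imaginary part of `y ↦ h_ℂ D̃(ι y)` vanishes identically near `y`, so its derivative does);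
  ★★★ `ofReal_fderiv_recordDtCorrOf_recordDt_apply` — `↑((D corr)(y) v)_i = (h_ℂ (DD̃(ι y) (ι v)))_i`: the real derivative IS the complex operator on the real slice.
* §2 ★★★ `ofReal_det_id_sub_fderiv_recordDtCorrOf_recordDt` — `↑(det_ℝ (id − fderiv ℝ corr y)) = det_ℂ (1 − h_ℂ ∘L fderiv ℂ (recordDt ρ) (ι y))` (standard bases: the complex matrix is the
  real one read in `ℂ`); `det_id_sub_fderiv_recordDtCorrOf_recordDt_ne_zero`.
* §3 ★★★ `recordDtJacOf_recordDt` — **DEF-1's (o3) socket formula at the record family is** `−Real.log ‖det (1 + h_ℂ ∘L DC̃_ℂ(ι Y))‖`, `Y = recordReparamOf F k (fun Vk => recordDt F k K Vk ρ) Vk g x`,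
  for `‖ι(g•x)‖ < ρ` (`det(1 − h_ℂ∘DD̃) = det(DΨ(Φ))⁻¹`, ✓`det_one_sub_hop_comp_fderiv_recordDt_eq_inv`; `Φ(ι(g•x)) = ι Y`, ✓`ofReal_recordReparamOf_recordDt`) — an EXPLICIT function of
  print's variable `B′ = Y` through the holomorphic family `B′ ↦ 1 + h_ℂ∘DC̃_ℂ(B′)` of ✓`…PortS1QtCPsi`, with NO `fderiv`-of-a-selector junk left.

HONEST FRAMING.  Linear-algebra∕calculus bookkeeping; the `Tr log` SERIES form (`log det(1+A) = Tr logOnePlus A`), its analyticity in `B′` on print's scaled domain and its size are the NEXT brick;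
nothing of Bałaban's renormalization-group estimates asserted, ported or discharged beyond this; `stub_FE` (XXL) ∕ `stub_P0C` OPEN, ⟨27930⟩ OPEN (1∕3); NODE O 0∕1; COUNT 8∕28 · K 1∕4 UNMOVED;
finite `𝕋⁴_{L^K}` at fixed ε — NOT continuum ∕ OS; **the Yang–Mills mass gap (Clay) is NOT proved by any of this.**  No `sorry`, no `def`, no `instance`; standard axioms only.
-/

noncomputable section

open scoped BigOperators Matrix.Norms.L2Operator Topology

open Set Metric Filter

namespace Summit.QuantumFields.YangMills.Theorems.BalabanUVNodesPortS1

open Summit.QuantumFields.YangMills.Theorems.K0RecordFormatNames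
open Literature.MathematicalPhysics.QuantumFieldTheory.Balaban1983to89
open Literature.MathematicalPhysics.QuantumFieldTheory.Balaban1983to89.Node00
open Literature.MathematicalPhysics.QuantumFieldTheory.Balaban1983to89.T4Continuum (T4Family)
open Literature.MathematicalPhysics.QuantumFieldTheory.Balaban1983to89.BlockAveraging (Small Idx)
open Literature.MathematicalPhysics.QuantumFieldTheory.Balaban1983to89.ExpMeanLog (expMeanLogSU)
open _root_.Matrix

section Letters

variable {F : T4Family}
variable {k K : ℕ} (hk : k + 1 ≤ (F.P K).m + (F.P K).K) (Vk : GaugeField (F.P K) k (SU 2)) {ε : ℝ}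
  (hε : ∀ (c : PBond (F.P K) (k + 1)) (i : Idx (F.P K)), ‖loopM (coeField Vk) c i - 1‖ ≤ ε) (hε50 : ε ≤ 1 / 50)
  (hVk : ∀ c, Small expMeanLogSU Vk c) {b ρ : ℝ} (hb : 0 ≤ b) (hHop : ∀ X, ‖hopLinGraphC F k K Vk X‖ ≤ b * ‖X‖)
  (hq : 9 * (2 * 1 / (1 / (10 ^ 8 * (F.P K).d * (F.P K).L)) ^ 2) * b * ρ < 1) (hρ : 3 * ρ ≤ 1 / (10 ^ 8 * (F.P K).d * (F.P K).L))

/-! ## §1  The real derivative of `recordDtCorrOf` is the complex operator `h_ℂ ∘L DD̃(↑y)` on the real slice -/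

include hk hε hε50 hVk hb hHop hq hρ in
/-- ★★ **`recordDtCorrOf` IS FRÉCHET-DIFFERENTIABLE AT REAL POINTS OF THE BALL**, with derivative `Re ∘ (h_ℂ ∘L DD̃(ι y))|_ℝ ∘ ι` (chain rule: `corr = Re ∘ h_ℂ ∘ D̃ ∘ ι`, `D̃` differentiable at `ι y` by
✓`hasFDerivAt_recordDt`). [cite: Balaban1987RG1, p.267 («an analytic function of B»), (2.12) p.268] -/
theorem hasFDerivAt_recordDtCorrOf_recordDt (y : FluctIdx F k K → ℝ) (hy : ‖(fun i => (y i : ℂ))‖ < ρ) :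
    HasFDerivAt (recordDtCorrOf F k (fun Vk => recordDt F k K Vk ρ) Vk)
      ((ContinuousLinearMap.pi fun i : FluctIdx F k K => Complex.reCLM.comp (ContinuousLinearMap.proj (R := ℝ) i)).comp
        ((((LinearMap.toContinuousLinearMap (hopLinGraphC F k K Vk)).comp
            (fderiv ℂ (recordDt F k K Vk ρ) (fun i => (y i : ℂ)))).restrictScalars ℝ).comp
          (ContinuousLinearMap.pi fun i : FluctIdx F k K => Complex.ofRealCLM.comp (ContinuousLinearMap.proj i)))) y := by
  set ι : (FluctIdx F k K → ℝ) →L[ℝ] (FluctIdx F k K → ℂ) :=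
    ContinuousLinearMap.pi fun i : FluctIdx F k K => Complex.ofRealCLM.comp (ContinuousLinearMap.proj i) with hιdef
  have hι : ∀ x : FluctIdx F k K → ℝ, ι x = fun i => (x i : ℂ) := fun x => rfl
  have hD : HasFDerivAt (recordDt F k K Vk ρ) (fderiv ℂ (recordDt F k K Vk ρ) (ι y)) (ι y) :=
    (hasFDerivAt_recordDt hk Vk hε hε50 hVk hb hHop hq hρ (B := ι y) (by rw [hι]; exact hy)).differentiableAt.hasFDerivAt
  have hG : HasFDerivAt (fun y' => (LinearMap.toContinuousLinearMap (hopLinGraphC F k K Vk)) (recordDt F k K Vk ρ (ι y')))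
      ((((LinearMap.toContinuousLinearMap (hopLinGraphC F k K Vk)).comp (fderiv ℂ (recordDt F k K Vk ρ) (ι y))).restrictScalars ℝ).comp ι) y :=
    (((LinearMap.toContinuousLinearMap (hopLinGraphC F k K Vk)).hasFDerivAt.comp (ι y) hD).restrictScalars ℝ).comp y ι.hasFDerivAt
  have hcorr : recordDtCorrOf F k (fun Vk => recordDt F k K Vk ρ) Vk =
      fun y' => (ContinuousLinearMap.pi fun i : FluctIdx F k K => Complex.reCLM.comp (ContinuousLinearMap.proj (R := ℝ) i))
        ((LinearMap.toContinuousLinearMap (hopLinGraphC F k K Vk)) (recordDt F k K Vk ρ (ι y'))) := by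
    funext y' i; rfl
  rw [hcorr]
  exact (ContinuousLinearMap.pi fun i : FluctIdx F k K => Complex.reCLM.comp (ContinuousLinearMap.proj (R := ℝ) i)).hasFDerivAt.comp y hG

include hk hε hε50 hVk hb hHop hq hρ in
/-- ★★ **THE DERIVATIVE ALONG REAL DIRECTIONS IS REAL**: `(h_ℂ (DD̃(ι y) (ι v)))_i` has zero imaginary part for every real `y` with `‖ι y‖ < ρ`, real `v` and index `i` — the imaginary part of
`y′ ↦ h_ℂ D̃(ι y′)` vanishes identically near `y` (✓`hopLinGraphC_recordDt_ofReal`), hence so does its derivative (uniqueness of the Fréchet derivative). [cite: Balaban1987RG1, p.267–268] -/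
theorem im_hop_fderiv_recordDt_ofReal_eq_zero (y : FluctIdx F k K → ℝ) (hy : ‖(fun i => (y i : ℂ))‖ < ρ) (v : FluctIdx F k K → ℝ) (i : FluctIdx F k K) :
    (hopLinGraphC F k K Vk (fderiv ℂ (recordDt F k K Vk ρ) (fun j => (y j : ℂ)) (fun j => (v j : ℂ))) i).im = 0 := by
  set ι : (FluctIdx F k K → ℝ) →L[ℝ] (FluctIdx F k K → ℂ) :=
    ContinuousLinearMap.pi fun i : FluctIdx F k K => Complex.ofRealCLM.comp (ContinuousLinearMap.proj i) with hιdef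
  have hι : ∀ x : FluctIdx F k K → ℝ, ι x = fun i => (x i : ℂ) := fun x => rfl
  set πim : (FluctIdx F k K → ℂ) →L[ℝ] (FluctIdx F k K → ℝ) :=
    ContinuousLinearMap.pi fun i : FluctIdx F k K => Complex.imCLM.comp (ContinuousLinearMap.proj (R := ℝ) i) with hπdef
  have hD : HasFDerivAt (recordDt F k K Vk ρ) (fderiv ℂ (recordDt F k K Vk ρ) (ι y)) (ι y) :=
    (hasFDerivAt_recordDt hk Vk hε hε50 hVk hb hHop hq hρ (B := ι y) (by rw [hι]; exact hy)).differentiableAt.hasFDerivAt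
  -- `G y' := Im (h_ℂ D̃(ι y'))` and its two derivatives at `y`
  have hG : HasFDerivAt (fun y' => πim ((LinearMap.toContinuousLinearMap (hopLinGraphC F k K Vk)) (recordDt F k K Vk ρ (ι y'))))
      (πim.comp ((((LinearMap.toContinuousLinearMap (hopLinGraphC F k K Vk)).comp (fderiv ℂ (recordDt F k K Vk ρ) (ι y))).restrictScalars ℝ).comp ι)) y :=
    πim.hasFDerivAt.comp y
      ((((LinearMap.toContinuousLinearMap (hopLinGraphC F k K Vk)).hasFDerivAt.comp (ι y) hD).restrictScalars ℝ).comp y ι.hasFDerivAt)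
  have hopen : IsOpen {y' : FluctIdx F k K → ℝ | ‖ι y'‖ < ρ} := isOpen_lt (continuous_norm.comp ι.continuous) continuous_const
  have hG0 : HasFDerivAt (fun y' => πim ((LinearMap.toContinuousLinearMap (hopLinGraphC F k K Vk)) (recordDt F k K Vk ρ (ι y'))))
      (0 : (FluctIdx F k K → ℝ) →L[ℝ] (FluctIdx F k K → ℝ)) y := by
    refine (hasFDerivAt_const (0 : FluctIdx F k K → ℝ) y).congr_of_eventuallyEq ?_
    filter_upwards [hopen.mem_nhds (show y ∈ {y' : FluctIdx F k K → ℝ | ‖ι y'‖ < ρ} by simpa [hι] using hy)] with y' hy'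
    have hy'' : ‖(fun j => (y' j : ℂ))‖ < ρ := by simpa [hι] using hy'
    funext j
    show (hopLinGraphC F k K Vk (recordDt F k K Vk ρ (ι y')) j).im = 0
    rw [hι, hopLinGraphC_recordDt_ofReal hk Vk hε hε50 hVk hb hHop hq hρ y' hy'', Complex.ofReal_im]
  have huniq := hG.unique hG0
  have h := congrArg (fun L : (FluctIdx F k K → ℝ) →L[ℝ] (FluctIdx F k K → ℝ) => L v i) huniq
  simpa [hπdef, hι] using h

include hk hε hε50 hVk hb hHop hq hρ in
/-- ★★★ **THE REAL DERIVATIVE IS THE COMPLEX OPERATOR ON THE REAL SLICE**: `↑((fderiv ℝ corr y v) i) = (h_ℂ (DD̃(ι y)(ι v)))_i` for `‖ι y‖ < ρ`. [cite: Balaban1987RG1, (2.12) p.268, p.267] -/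
theorem ofReal_fderiv_recordDtCorrOf_recordDt_apply (y : FluctIdx F k K → ℝ) (hy : ‖(fun i => (y i : ℂ))‖ < ρ) (v : FluctIdx F k K → ℝ) (i : FluctIdx F k K) :
    (((fderiv ℝ (recordDtCorrOf F k (fun Vk => recordDt F k K Vk ρ) Vk) y v) i : ℝ) : ℂ) =
      hopLinGraphC F k K Vk (fderiv ℂ (recordDt F k K Vk ρ) (fun j => (y j : ℂ)) (fun j => (v j : ℂ))) i := by
  rw [(hasFDerivAt_recordDtCorrOf_recordDt hk Vk hε hε50 hVk hb hHop hq hρ y hy).fderiv]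
  have him := im_hop_fderiv_recordDt_ofReal_eq_zero hk Vk hε hε50 hVk hb hHop hq hρ y hy v i
  apply Complex.ext
  · simp
  · rw [Complex.ofReal_im, him]

/-! ## §2  `det_ℝ (id − D corr) = det_ℂ (1 − h_ℂ ∘L DD̃(↑y))` -/

open Classical in
include hk hε hε50 hVk hb hHop hq hρ in
/-- ★★★ **THE REAL JACOBIAN DETERMINANT IS THE COMPLEX ONE**: `↑(det_ℝ (id − fderiv ℝ corr y)) = det_ℂ (1 − h_ℂ ∘L fderiv ℂ (recordDt ρ) (ι y))` for `‖ι y‖ < ρ` — in the standard bases the complex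
matrix is the real matrix read in `ℂ` (§1), and `det` commutes with `ℝ → ℂ`. [cite: Balaban1987RG1, (2.12) p.268] -/
theorem ofReal_det_id_sub_fderiv_recordDtCorrOf_recordDt (y : FluctIdx F k K → ℝ) (hy : ‖(fun i => (y i : ℂ))‖ < ρ) :
    ((LinearMap.det ((ContinuousLinearMap.id ℝ (FluctIdx F k K → ℝ) -
        fderiv ℝ (recordDtCorrOf F k (fun Vk => recordDt F k K Vk ρ) Vk) y).toLinearMap) : ℝ) : ℂ) =
      LinearMap.det (((1 : (FluctIdx F k K → ℂ) →L[ℂ] (FluctIdx F k K → ℂ)) -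
        (LinearMap.toContinuousLinearMap (hopLinGraphC F k K Vk)).comp (fderiv ℂ (recordDt F k K Vk ρ) (fun j => (y j : ℂ)))).toLinearMap) := by
  set Tr : (FluctIdx F k K → ℝ) →ₗ[ℝ] (FluctIdx F k K → ℝ) := (ContinuousLinearMap.id ℝ (FluctIdx F k K → ℝ) -
        fderiv ℝ (recordDtCorrOf F k (fun Vk => recordDt F k K Vk ρ) Vk) y).toLinearMap with hTr
  set Tc : (FluctIdx F k K → ℂ) →ₗ[ℂ] (FluctIdx F k K → ℂ) := (((1 : (FluctIdx F k K → ℂ) →L[ℂ] (FluctIdx F k K → ℂ)) -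
        (LinearMap.toContinuousLinearMap (hopLinGraphC F k K Vk)).comp (fderiv ℂ (recordDt F k K Vk ρ) (fun j => (y j : ℂ)))).toLinearMap) with hTc
  have hTc_apply : ∀ (w : FluctIdx F k K → ℂ) (i' : FluctIdx F k K),
      Tc w i' = w i' - hopLinGraphC F k K Vk (fderiv ℂ (recordDt F k K Vk ρ) (fun j => (y j : ℂ)) w) i' := fun _ _ => rfl
  have hTr_apply : ∀ (w : FluctIdx F k K → ℝ) (i' : FluctIdx F k K),
      Tr w i' = w i' - fderiv ℝ (recordDtCorrOf F k (fun Vk => recordDt F k K Vk ρ) Vk) y w i' := fun _ _ => rfl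
  have hmat : LinearMap.toMatrix' Tc = (algebraMap ℝ ℂ).mapMatrix (LinearMap.toMatrix' Tr) := by
    ext i j
    rw [RingHom.mapMatrix_apply, Matrix.map_apply, LinearMap.toMatrix'_apply, LinearMap.toMatrix'_apply, hTc_apply, hTr_apply,
      Complex.coe_algebraMap, Complex.ofReal_sub,
      ofReal_fderiv_recordDtCorrOf_recordDt_apply hk Vk hε hε50 hVk hb hHop hq hρ y hy (Pi.single j (1 : ℝ)) i, ← ofReal_comp_single j]
  have h1 : LinearMap.det Tc = (LinearMap.toMatrix' Tc).det := (LinearMap.det_toMatrix' Tc).symm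
  have h2 : LinearMap.det Tr = (LinearMap.toMatrix' Tr).det := (LinearMap.det_toMatrix' Tr).symm
  rw [h1, h2, hmat, ← RingHom.map_det, Complex.coe_algebraMap]

include hk hε hε50 hVk hb hHop hq hρ in
/-- `det_ℝ (id − fderiv ℝ corr y) ≠ 0` for `‖ι y‖ < ρ`. [cite: Balaban1987RG1, (2.12) p.268] -/
theorem det_id_sub_fderiv_recordDtCorrOf_recordDt_ne_zero (y : FluctIdx F k K → ℝ) (hy : ‖(fun i => (y i : ℂ))‖ < ρ) :
    LinearMap.det ((ContinuousLinearMap.id ℝ (FluctIdx F k K → ℝ) -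
        fderiv ℝ (recordDtCorrOf F k (fun Vk => recordDt F k K Vk ρ) Vk) y).toLinearMap) ≠ 0 := by
  intro h0
  have h := ofReal_det_id_sub_fderiv_recordDtCorrOf_recordDt hk Vk hε hε50 hVk hb hHop hq hρ y hy
  rw [h0, Complex.ofReal_zero, det_one_sub_hop_comp_fderiv_recordDt_eq_inv hk Vk hε hε50 hVk hb hHop hq hρ hy] at h
  exact det_fderiv_recordPsi_recordPhi_ne_zero hk Vk hε hε50 hVk hb hHop hq hρ hy (inv_eq_zero.1 h.symm)

/-! ## §3  `recordDtJacOf` at the record family, explicitly -/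

include hk hε hε50 hVk hb hHop hq hρ in
/-- ★★★ **DEF-1's (o3) SOCKET FORMULA AT THE `recordDt` FAMILY, EXPLICIT**: for `‖ι(g•x)‖ < ρ`,
`recordDtJacOf F k (fun Vk => recordDt F k K Vk ρ) Vk g x = −Real.log ‖det (1 + h_ℂ ∘L DC̃_ℂ(ι Y))‖`, `Y = recordReparamOf F k (fun Vk => recordDt F k K Vk ρ) Vk g x` — print's `log|det(1 − h δD̃∕δB)(g_kB)|`
equals minus the log-modulus of the determinant of the explicit holomorphic family `B′ ↦ 1 + h_ℂ∘DC̃_ℂ(B′)` at the translated point `B′ = Y_g(x)`. [cite: Balaban1987RG1, (2.12) p.268, p.267] -/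
theorem recordDtJacOf_recordDt (g : ℝ) (x : FluctIdx F k K → ℝ) (hgx : ‖(fun i => ((g • x) i : ℂ))‖ < ρ) :
    recordDtJacOf F k (fun Vk => recordDt F k K Vk ρ) Vk g x =
      -Real.log ‖LinearMap.det (((1 : (FluctIdx F k K → ℂ) →L[ℂ] (FluctIdx F k K → ℂ)) +
        (LinearMap.toContinuousLinearMap (hopLinGraphC F k K Vk)).comp
          (fderiv ℂ (recordCtC F k K Vk) (fun i => ((recordReparamOf F k (fun Vk => recordDt F k K Vk ρ) Vk g x) i : ℂ)))).toLinearMap)‖ := by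
  unfold recordDtJacOf
  have hdet := ofReal_det_id_sub_fderiv_recordDtCorrOf_recordDt hk Vk hε hε50 hVk hb hHop hq hρ (g • x) hgx
  rw [det_one_sub_hop_comp_fderiv_recordDt_eq_inv hk Vk hε hε50 hVk hb hHop hq hρ hgx,
    ← ofReal_recordReparamOf_recordDt hk Vk hε hε50 hVk hb hHop hq hρ g x hgx] at hdet
  have habs : |LinearMap.det ((ContinuousLinearMap.id ℝ (FluctIdx F k K → ℝ) -
        fderiv ℝ (recordDtCorrOf F k (fun Vk => recordDt F k K Vk ρ) Vk) (g • x)).toLinearMap)| =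
      ‖LinearMap.det (((1 : (FluctIdx F k K → ℂ) →L[ℂ] (FluctIdx F k K → ℂ)) +
        (LinearMap.toContinuousLinearMap (hopLinGraphC F k K Vk)).comp
          (fderiv ℂ (recordCtC F k K Vk) (fun i => ((recordReparamOf F k (fun Vk => recordDt F k K Vk ρ) Vk g x) i : ℂ)))).toLinearMap)‖⁻¹ := by
    rw [← Real.norm_eq_abs, ← Complex.norm_real, hdet, norm_inv]
  rw [habs, Real.log_inv]

end Letters

end Summit.QuantumFields.YangMills.Theorems.BalabanUVNodesPortS1

end
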